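import Literature.Algebra.Homology.HomologyBaseChangeFlat
import Literature.Algebra.Homology.TraceBaseChangeTorsion
import Literature.Algebra.Homology.EulerPoincareRank
import HarnessLib

/-!
# The Hopf trace formula over `ℤ` ∕ a PID (Hatcher Thm. 2C.3 as printed): traces on homology modulo torsion

Layer `Literature/Algebra/Homology` (pure algebra over Mathlib; proved theorems only, 0 definitions, 0 named facts, no instances, no notation).
LEAF B after rows `HopfTraceFormulaBaseChange` (chain level `f(Σᶠ χ•tr_R φᵢ) = Λ(K ⊗_R φ)`), `HomologyBaseChangeFlat` (flat base change of
homology; the FREE-homology case over `ℤ`) and `TraceBaseChangeTorsion` (LEAF A: `tr_K(u_K) = f(tr_R(ū on M ⧸ torsion))`). Hatcher, *Algebraic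
Topology*, §2.C: the Lefschetz number of a map of a finite CW complex is `τ(f) = Σₙ (−1)ⁿ tr(f_* : Hₙ(X) → Hₙ(X))`, the trace of an endomorphism
of a finitely generated abelian group being that of the induced endomorphism of its torsion-free quotient, and (proof of Thm. 2C.3, "the analog of
Theorem 2.44 for trace instead of rank") `τ(f) = Σₙ (−1)ⁿ tr(f♯ : Cₙ → Cₙ)` on the cellular chains. Setting: a commutative domain `R`, a field `K`,
a flat injective `f : R →+* K` (`ℤ ⊆ ℚ`: row `HomologyBaseChangeFlat`'s `Int.castRingHom_rat_flat`), a complex `C` of `R`-modules of ANY shape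
with `EulerCharSigns`, an endomorphism `φ`; `H̄ₙ(φ)` is the endomorphism of `Hₙ(C) ⧸ torsion` induced by `Hₙ(φ)` (Mathlib's `Submodule.mapQ` along
LEAF A's `torsion_le_comap`; no new object).

* `trace_homologyMap_extendScalars_eq_map_trace_mapQ` — `tr_K Hₙ(K ⊗_R φ) = f(tr_R H̄ₙ(φ))` whenever `Hₙ(C) ⧸ torsion` is finitely generated free
  (row `HomologyBaseChangeFlat`'s conjugacy `Hₙ(K ⊗_R C) ≃ K ⊗_R Hₙ(C)` + LEAF A, BY NAME); `lefschetzNumber_extendScalars_eq_map_finsum_trace_mapQ` —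
  `Λ(K ⊗_R φ) = f(Σᶠ χ(n) • tr_R H̄ₙ(φ))` (row `LefschetzNumber`'s `Λ`, no new def); `moduleFinite_homology_of_isNoetherianRing`;
* over a PRINCIPAL IDEAL DOMAIN (every `Hₙ ⧸ torsion` is then free), for finitely generated free terms with finitely many non-zero ranks:
  **`finsum_χ_smul_trace_f_eq_finsum_χ_smul_trace_homology_mapQ : Σᶠ χ(i) • tr_R(φᵢ) = Σᶠ χ(n) • tr_R(H̄ₙ(φ))`** in `R` — Thm. 2C.3's algebra
  VERBATIM (the homology may have torsion), its `φ = 𝟙` reading `finsum_χ_smul_finrank_eq_finsum_χ_smul_finrank_homology_quotient_torsion`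
  (`Σᶠ χ•rank Cᵢ = Σᶠ χ•rank (Hₙ ⧸ torsion)`; with `rank (Hₙ ⧸ torsion) = rank Hₙ` this is row `EulerPoincareRank`, Thm. 2.44), and the
  instance **`Int.finsum_χ_smul_trace_f_eq` (`R = ℤ`, `K = ℚ`)**, in whose statement the `ℤ`-module structure of `Hₙ ⧸ torsion` is Mathlib's
  `Submodule.Quotient.module` written explicitly (instance search on a quotient of a bundled `ModuleCat ℤ` object would select the propositionally
  but not definitionally equal `AddCommGroup.toIntModule`).

`[(ModuleCat.extendScalars f).Additive]` is an instance HYPOTHESIS as in rows `HopfTraceFormulaBaseChange` ∕ `HomologyBaseChangeFlat` (Mathlib does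
not register it; dischargeable by the tree's `Literature.Algebra.Homology.additive_extendScalars`). Library only (cell `pub-hodge-ring2`,
count-neutral); proves nothing about any crux, route or conjecture.

## References

* A. Hatcher, *Algebraic Topology* (2002), §2.C, Thm. 2C.3 and its proof (Hopf trace formula over `ℤ`). [HatcherAT2002]
* E. H. Spanier, *Algebraic Topology* (1981), Ch. 4 §7, Thm. 6–7. [Spanier1981]
* K. S. Brown, *Cohomology of Groups* (1982), IX §§6–7 (Euler characteristics and ranks over `ℤ` via `ℚ ⊗ −`). [Brown1982]
-/

open CategoryTheory CategoryTheory.Limits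

universe u w

namespace Literature.Algebra.Homology.HopfTrace

open Submodule (torsion)
open TraceBaseChangeTorsion (torsion_le_comap)

variable {R K : Type u} [CommRing R] [IsDomain R] [Field K] (f : R →+* K) [(ModuleCat.extendScalars.{u, u, u} f).Additive]
  {ι : Type w} {c : ComplexShape ι} (C : HomologicalComplex (ModuleCat.{u} R) c) (φ : C ⟶ C)

/-- **`tr_K Hₙ(K ⊗_R φ) = f(tr_R H̄ₙ(φ))`**, `H̄ₙ(φ)` the endomorphism of `Hₙ(C) ⧸ torsion` induced by `Hₙ(φ)`, for `f` flat and injective and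
`Hₙ(C) ⧸ torsion` finitely generated free (row `HomologyBaseChangeFlat`'s conjugacy + LEAF A). [cite: HatcherAT2002, Thm. 2C.3] -/
theorem trace_homologyMap_extendScalars_eq_map_trace_mapQ (hf : f.Flat) (hinj : Function.Injective f) (n : ι)
    [Module.Free R (C.homology n ⧸ torsion R (C.homology n))] [Module.Finite R (C.homology n ⧸ torsion R (C.homology n))] :
    LinearMap.trace K _ (HomologicalComplex.homologyMap (((ModuleCat.extendScalars f).mapHomologicalComplex c).map φ) n).hom =
      f (LinearMap.trace R _ ((torsion R (C.homology n)).mapQ (torsion R (C.homology n)) (HomologicalComplex.homologyMap φ n).hom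
        (torsion_le_comap _))) := by
  obtain ⟨e, he⟩ := exists_conj_homologyMap_extendScalars f C φ hf n
  have h : (HomologicalComplex.homologyMap (((ModuleCat.extendScalars f).mapHomologicalComplex c).map φ) n).hom =
      e.symm.conj ((ModuleCat.extendScalars f).map (HomologicalComplex.homologyMap φ n)).hom := by
    rw [LinearEquiv.conj_apply, LinearEquiv.symm_symm, LinearMap.comp_assoc, ← he, ← LinearMap.comp_assoc, LinearEquiv.symm_comp,
      LinearMap.id_comp]
  rw [h, LinearMap.trace_conj']
  letI : Algebra R K := ((algebraMap K K).comp f).toAlgebra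
  exact TraceBaseChangeTorsion.trace_baseChange_eq_map_trace_mapQ K hinj (HomologicalComplex.homologyMap φ n).hom

/-- **`Λ(K ⊗_R φ) = f(Σᶠ χ(n) • tr_R H̄ₙ(φ))`** (row `LefschetzNumber`'s `Λ`; `f` flat and injective, every `Hₙ(C) ⧸ torsion` finitely generated
free, the signed traces finitely supported). [cite: HatcherAT2002, Thm. 2C.3] [cite: Spanier1981, Ch. 4 §7] -/
theorem lefschetzNumber_extendScalars_eq_map_finsum_trace_mapQ (hf : f.Flat) (hinj : Function.Injective f) [c.EulerCharSigns]
    [∀ n, Module.Free R (C.homology n ⧸ torsion R (C.homology n))] [∀ n, Module.Finite R (C.homology n ⧸ torsion R (C.homology n))]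
    (hs : (fun n => (c.χ n : ℤ) • LinearMap.trace R _ ((torsion R (C.homology n)).mapQ (torsion R (C.homology n))
      (HomologicalComplex.homologyMap φ n).hom (torsion_le_comap _))).HasFiniteSupport) :
    Lefschetz.lefschetzNumber (((ModuleCat.extendScalars f).mapHomologicalComplex c).map φ) =
      f (∑ᶠ n, (c.χ n : ℤ) • LinearMap.trace R _ ((torsion R (C.homology n)).mapQ (torsion R (C.homology n))
        (HomologicalComplex.homologyMap φ n).hom (torsion_le_comap _))) := by
  rw [map_finsum f hs]
  exact finsum_congr fun n => by rw [map_zsmul, ← trace_homologyMap_extendScalars_eq_map_trace_mapQ f C φ hf hinj n]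

omit [IsDomain R] in
/-- Over a noetherian ring, `Hₙ(C)` is finitely generated when `Cₙ` is (a subquotient). [cite: HatcherAT2002, §2.C] -/
theorem moduleFinite_homology_of_isNoetherianRing [IsNoetherianRing R] (n : ι) [Module.Finite R (C.X n)] : Module.Finite R (C.homology n) :=
  haveI : Module.Finite R (C.sc n).X₂ := inferInstanceAs (Module.Finite R (C.X n))
  haveI : Module.Finite R (C.sc n).moduleCatLeftHomologyData.H :=
    inferInstanceAs (Module.Finite R (LinearMap.ker (C.sc n).g.hom ⧸ LinearMap.range (C.sc n).moduleCatToCycles))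
  Module.Finite.equiv (C.sc n).moduleCatHomologyIso.toLinearEquiv.symm

/-! ### Over a principal ideal domain: Thm. 2C.3 as printed -/

section PID

variable [IsPrincipalIdealRing R] [c.EulerCharSigns] [∀ i, Module.Free R (C.X i)] [∀ i, Module.Finite R (C.X i)]

omit [∀ i, Module.Free R (C.X i)] in
/-- The signed traces `χ(n) • tr_R H̄ₙ(φ)` are finitely supported when the chain modules have finitely many non-zero ranks
(`rank (Hₙ ⧸ torsion) ≤ rank Hₙ ≤ rank Cₙ`, row `EulerPoincareRank`). [cite: HatcherAT2002, Thm. 2C.3 (proof)] -/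
theorem hasFiniteSupport_χ_smul_trace_homology_mapQ (hC : (GradedObject.finrankSupport C.X).Finite) :
    (fun n => (c.χ n : ℤ) • LinearMap.trace R _ ((torsion R (C.homology n)).mapQ (torsion R (C.homology n))
      (HomologicalComplex.homologyMap φ n).hom (torsion_le_comap _))).HasFiniteSupport := by
  haveI : ∀ n, Module.Finite R (C.homology n) := fun n => moduleFinite_homology_of_isNoetherianRing C n
  refine hC.subset fun n hn => ?_
  simp only [GradedObject.finrankSupport, Function.mem_support, ne_eq] at hn ⊢
  intro h0
  have h1 : Module.finrank R (C.homology n ⧸ torsion R (C.homology n)) = 0 :=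
    Nat.eq_zero_of_le_zero (((torsion R _).finrank_quotient_le).trans ((EulerPoincareRank.finrank_homology_le C n).trans h0.le))
  exact hn (by rw [trace_eq_zero_of_finrank_eq_zero (ModuleCat.of R (C.homology n ⧸ torsion R (C.homology n))) h1, smul_zero])

/-- **The Hopf trace formula over a principal ideal domain (Hatcher Thm. 2C.3, Spanier 4.7.6, as printed for `R = ℤ`)**: given a flat
injective ring map `f` to a field (`R ⊆ Frac R`), for an endomorphism `φ` of a complex of finitely generated free `R`-modules of any shape
with `EulerCharSigns` and finitely many non-zero ranks,
`Σᶠ i, χ(i) • tr(φᵢ : Cᵢ → Cᵢ) = Σᶠ n, χ(n) • tr(H̄ₙ(φ) : Hₙ(C)⁄torsion → Hₙ(C)⁄torsion)` in `R` (the homology may have torsion).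
[cite: HatcherAT2002, Thm. 2C.3] [cite: Spanier1981, Ch. 4 §7 Thm. 6] -/
theorem finsum_χ_smul_trace_f_eq_finsum_χ_smul_trace_homology_mapQ (hf : f.Flat) (hinj : Function.Injective f)
    (hC : (GradedObject.finrankSupport C.X).Finite) :
    ∑ᶠ i, (c.χ i : ℤ) • LinearMap.trace R (C.X i) (φ.f i).hom =
      ∑ᶠ n, (c.χ n : ℤ) • LinearMap.trace R _ ((torsion R (C.homology n)).mapQ (torsion R (C.homology n))
        (HomologicalComplex.homologyMap φ n).hom (torsion_le_comap _)) := by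
  haveI : ∀ n, Module.Finite R (C.homology n) := fun n => moduleFinite_homology_of_isNoetherianRing C n
  exact hinj ((map_finsum_χ_smul_trace_f f C φ hC).trans
    (lefschetzNumber_extendScalars_eq_map_finsum_trace_mapQ f C φ hf hinj (hasFiniteSupport_χ_smul_trace_homology_mapQ C φ hC)))

/-- **`φ = 𝟙`: `Σᶠ χ(i) • rank Cᵢ = Σᶠ χ(n) • rank (Hₙ(C) ⁄ torsion)`** (the trace of the identity is the rank; with
`rank (Hₙ ⁄ torsion) = rank Hₙ` this is Thm. 2.44, row `EulerPoincareRank`). [cite: HatcherAT2002, Thm. 2.44] [cite: HatcherAT2002, Thm. 2C.3] -/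
theorem finsum_χ_smul_finrank_eq_finsum_χ_smul_finrank_homology_quotient_torsion (hf : f.Flat) (hinj : Function.Injective f)
    (hC : (GradedObject.finrankSupport C.X).Finite) :
    ∑ᶠ i, (c.χ i : ℤ) • (Module.finrank R (C.X i) : R) =
      ∑ᶠ n, (c.χ n : ℤ) • (Module.finrank R (C.homology n ⧸ torsion R (C.homology n)) : R) := by
  haveI : ∀ n, Module.Finite R (C.homology n) := fun n => moduleFinite_homology_of_isNoetherianRing C n
  have h := finsum_χ_smul_trace_f_eq_finsum_χ_smul_trace_homology_mapQ f C (𝟙 C) hf hinj hC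
  simp only [HomologicalComplex.id_f, ModuleCat.hom_id, LinearMap.trace_id] at h
  rw [h]
  refine finsum_congr fun n => ?_
  rw [← LinearMap.trace_id]
  congr 2
  refine LinearMap.ext fun x => ?_
  obtain ⟨x, rfl⟩ := Submodule.mkQ_surjective _ x
  rw [Submodule.mkQ_apply, Submodule.mapQ_apply, HomologicalComplex.homologyMap_id, ModuleCat.hom_id, LinearMap.id_apply,
    LinearMap.id_apply]

end PID

/-! ### `R = ℤ`, `K = ℚ` -/

/-- **Hatcher's Thm. 2C.3 over `ℤ`, verbatim**: for an endomorphism `φ` of a complex of finitely generated free abelian groups (any shape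
with `EulerCharSigns`, finitely many non-zero ranks), `Σᶠ χ(i) • tr_ℤ(φᵢ) = Σᶠ χ(n) • tr_ℤ(H̄ₙ(φ) on Hₙ(C) ⁄ torsion)` in `ℤ`; the
`ℤ`-module structure on the quotient is Mathlib's `Submodule.Quotient.module`, written explicitly (see the module docstring).
[cite: HatcherAT2002, Thm. 2C.3] -/
theorem Int.finsum_χ_smul_trace_f_eq {ι : Type w} {c : ComplexShape ι} [c.EulerCharSigns] (C : HomologicalComplex (ModuleCat.{0} ℤ) c)
    (φ : C ⟶ C) [(ModuleCat.extendScalars.{0, 0, 0} (Int.castRingHom ℚ)).Additive] [∀ i, Module.Free ℤ (C.X i)]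
    [∀ i, Module.Finite ℤ (C.X i)] (hC : (GradedObject.finrankSupport C.X).Finite) :
    ∑ᶠ i, (c.χ i : ℤ) • LinearMap.trace ℤ (C.X i) (φ.f i).hom =
      ∑ᶠ n, (c.χ n : ℤ) • @LinearMap.trace ℤ _ (C.homology n ⧸ torsion ℤ (C.homology n)) _ (Submodule.Quotient.module _)
        ((torsion ℤ (C.homology n)).mapQ (torsion ℤ (C.homology n)) (HomologicalComplex.homologyMap φ n).hom (torsion_le_comap _)) :=
  finsum_χ_smul_trace_f_eq_finsum_χ_smul_trace_homology_mapQ (Int.castRingHom ℚ) C φ castRingHom_rat_flat (Int.cast_injective (α := ℚ)) hC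

end Literature.Algebra.Homology.HopfTrace
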